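import Literature.NumberTheory.EllipticCurves.Monsky1990.DescentLemmaSigns
import HarnessLib

/-!
# Monsky 1990, Lemmas 5.4 and 5.8 (= 4.10): the Galois bookkeeping, in a field

Monsky, *Mock Heegner points and congruent numbers*, Math. Z. 204 (1990), pp. 59, 62–63. Both descent
lemmas reduce, through the explicit `2`-descent on `E : y² = x³ − x` (sibling file
`DescentLemmaPoints.lean`), to statements about a field `H ⊇ ℚ(i, √2, √p, √q)` with two automorphisms
`σ`, `τ` and three square roots `s₀² = u`, `s₁² = u − 1`, `sp² = u + 1` of a rational `u` satisfying
`u(u + 1)(u − 1) = −N v²`: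

* **Lemma 5.4** (`D = p₃p₅`, here `q = p₃ ≡ 3 (8)`, `p = p₅ ≡ 5 (8)`, `N ∣ 2pq`): `σ` fixes `i, √2` and moves
  `√p, √q`; `τ` moves `i, √q` and fixes `√2, √p`. If `σ` moves `√u`, `√(u + 1)` and fixes `√(u − 1)`, while
  `τ` fixes `√u` and moves `√(u − 1)`, `√(u + 1)`, then there is no such `u` (`lemma54_field`): Monsky
  p. 62, "It follows that `σ` moves `√u` and `√(u + 1)` while `τ` fixes `√u` and moves `√(u + 1)`. … The
  conditions above force `u` to be `p₅ (square)` or `2p₅ (square)` and `u + 1` to be `p₃ (square)` or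
  `2p₃ (square)`. … So eight cases arise. But they are all impossible." The translation by the
  `4`-division point (Monsky: "we may translate `P` by the `4`-division point `(0, 1/√2)` … and so may
  assume that `2P ∈ (iC_ℝ)⁻`") is the substitution `u ↦ (u + 1)/(u − 1)` inside `lemma54_field`.
* **Lemma 5.8 / 4.10** (`D = p₅p₇`, here `q = p₇`, `N = q`): `σ` fixes `i, √q` and moves `√2`; then `σ`
  fixes `√u` (`lemma58_field`): Monsky p. 59, "Suppose on the contrary that `β(√u) = −√u`. Then `u` must be
  `±2 (square)` or `±2p₇ (square)`. So the exponent to which `2` appears in `u³ − u` is odd, contradicting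
  the fact that `u³ − u = −p₇v²`."

The `2`-adic arithmetic ("eight cases") is `DescentLemmaCases.no_solution_of_square_classes`, the square
classes come from `TwoAdicSquareClasses`, and the Galois-sign bookkeeping on `0 < u < 1` is
`DescentLemmaSigns.lemma54_field_pos`. Everything is fully proved; no named facts.

## References

* P. Monsky, Mock Heegner points and congruent numbers, Math. Z. 204 (1990) 45–67, Lemma 4.10 (p. 59),
  Lemma 5.4 (p. 62), Lemma 5.8 (p. 63). [Monsky1990MockHeegner]
-/

noncomputable section

namespace Literature.NumberTheory.EllipticCurves.Monsky1990

variable {H : Type*} [Field H] [CharZero H]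

/-! ### Lemma 5.4 -/

/-- **Monsky 1990, Lemma 5.4, field form** (the translation by the `4`-division point removed): as
`lemma54_field_pos` but for every rational `u` with `u(u + 1)(u − 1) = −N v²`, `v ≠ 0`. For `u < −1` the
substitution `u ↦ (u + 1)/(u − 1) ∈ (0, 1)`, `s₀ ↦ sp/s₁`, `s₁ ↦ √2/s₁`, `sp ↦ √2 s₀/s₁` preserves all the
hypotheses (Monsky p. 62: "We may translate `P` by the `4`-division point `(0, 1/√2)` without changing
`P^σ − P` or `P^τ − P` and so may assume that `2P ∈ (iC_ℝ)⁻`").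
[cite: Monsky1990MockHeegner, Lemma 5.4 (p. 62)] -/
theorem lemma54_field (σ τ : H →+* H) {θ₂ θp θq θi : H} {p q N : ℕ} (hp : p.Prime) (hq : q.Prime)
    (hp8 : p % 8 = 5) (hq8 : q % 8 = 3) (hN : N ∣ 2 * p * q) (hN0 : N ≠ 0)
    (h₂ : θ₂ ^ 2 = 2) (hpθ : θp ^ 2 = p) (hqθ : θq ^ 2 = q) (hi : θi ^ 2 = -1)
    (hσ₂ : σ θ₂ = θ₂) (hσp : σ θp = -θp) (hσq : σ θq = -θq) (hσi : σ θi = θi)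
    (hτ₂ : τ θ₂ = θ₂) (hτp : τ θp = θp) (hτq : τ θq = -θq) (hτi : τ θi = -θi)
    {u v : ℚ} (hv : v ≠ 0) (hcubic : u * (u + 1) * (u - 1) = -(N : ℚ) * v ^ 2)
    {s₀ s₁ sp : H} (hs₀ : s₀ ^ 2 = u) (hs₁ : s₁ ^ 2 = ((u - 1 : ℚ) : H)) (hsp : sp ^ 2 = ((u + 1 : ℚ) : H))
    (hσ0 : σ s₀ = -s₀) (hσ1 : σ s₁ = s₁) (hσ2 : σ sp = -sp)
    (hτ0 : τ s₀ = s₀) (hτ1 : τ s₁ = -s₁) (hτ2 : τ sp = -sp) : False := by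
  -- `u(u + 1)(u − 1) < 0` forces `u < −1` or `0 < u < 1`
  have hNpos : (0 : ℚ) < N := by exact_mod_cast Nat.pos_of_ne_zero hN0
  have hneg : u * (u + 1) * (u - 1) < 0 := by
    rw [hcubic]
    have hv2 : 0 < v ^ 2 := by positivity
    nlinarith
  have hcases : u < -1 ∨ (0 < u ∧ u < 1) := by
    rcases lt_or_ge u (-1) with h | h
    · exact Or.inl h
    rcases lt_or_ge u 0 with h' | h'
    · exfalso
      have h1 : 0 ≤ u + 1 := by linarith
      have h2 : u - 1 < 0 := by linarith
      nlinarith [mul_nonneg_of_nonpos_of_nonpos h'.le h2.le]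
    rcases lt_or_ge u 1 with h'' | h''
    · rcases eq_or_lt_of_le h' with h0 | h0
      · exfalso; rw [← h0] at hneg; simp at hneg
      · exact Or.inr ⟨h0, h''⟩
    · exfalso
      have h1 : 0 < u + 1 := by linarith
      have h2 : 0 ≤ u - 1 := by linarith
      nlinarith [mul_nonneg (by linarith : (0 : ℚ) ≤ u) h1.le]
  rcases hcases with hlt | ⟨hu0, hu1⟩
  · -- translate: `u' = (u + 1)/(u − 1)`
    have hu1' : (u - 1 : ℚ) ≠ 0 := by linarith
    have hs₁0 : s₁ ≠ 0 := by
      intro h; rw [h, zero_pow two_ne_zero] at hs₁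
      exact hu1' (by exact_mod_cast hs₁.symm)
    set u' : ℚ := (u + 1) / (u - 1) with hu'
    have hu'0 : 0 < u' := by
      rw [hu']
      exact div_pos_of_neg_of_neg (by linarith) (by linarith)
    have hu'1 : u' < 1 := by
      rw [hu', div_lt_one_of_neg (by linarith)]
      linarith
    have hcubic' : u' * (u' + 1) * (u' - 1) = -(N : ℚ) * (2 * v / (u - 1) ^ 2) ^ 2 := by
      have hden : (u - 1) ^ 4 ≠ 0 := pow_ne_zero 4 hu1'
      have e1 : u' * (u' + 1) * (u' - 1) * (u - 1) ^ 4 = 4 * (u * (u + 1) * (u - 1)) := by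
        rw [hu']; field_simp; ring
      have e2 : -(N : ℚ) * (2 * v / (u - 1) ^ 2) ^ 2 * (u - 1) ^ 4 = 4 * (-(N : ℚ) * v ^ 2) := by
        field_simp; ring
      apply mul_right_cancel₀ hden
      rw [e1, e2, hcubic]
    have hv' : 2 * v / (u - 1) ^ 2 ≠ 0 := by
      apply div_ne_zero (mul_ne_zero two_ne_zero hv) (pow_ne_zero 2 hu1')
    have hs₁H : s₁ ^ 2 = (u : H) - 1 := by rw [hs₁]; push_cast; ring
    refine lemma54_field_pos σ τ hp hq hp8 hq8 hN hN0 h₂ hpθ hqθ hi hσ₂ hσp hσq hσi hτ₂ hτp hτq hτi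
      hu'0 hu'1 hv' hcubic' (s₀ := sp / s₁) (s₁ := θ₂ / s₁) (sp := θ₂ * s₀ / s₁) ?_ ?_ ?_ ?_ ?_ ?_ ?_ ?_ ?_
    · rw [div_pow, hsp, hs₁, hu']; push_cast; ring
    · rw [div_pow, h₂, hs₁H, hu']
      have : (u : H) - 1 ≠ 0 := by
        have := (Rat.cast_ne_zero (α := H)).mpr hu1'
        push_cast at this
        exact this
      push_cast
      field_simp
      ring
    · rw [mul_div_assoc, mul_pow, div_pow, h₂, hs₀, hs₁H, hu']
      have : (u : H) - 1 ≠ 0 := by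
        have := (Rat.cast_ne_zero (α := H)).mpr hu1'
        push_cast at this
        exact this
      push_cast
      field_simp
      ring
    · rw [map_div₀, hσ2, hσ1, neg_div]
    · rw [map_div₀, hσ₂, hσ1]
    · rw [map_div₀, map_mul, hσ₂, hσ0, hσ1, mul_neg, neg_div]
    · rw [map_div₀, hτ2, hτ1, neg_div_neg_eq]
    · rw [map_div₀, hτ₂, hτ1, div_neg]
    · rw [map_div₀, map_mul, hτ₂, hτ0, hτ1, div_neg]
  · exact lemma54_field_pos σ τ hp hq hp8 hq8 hN hN0 h₂ hpθ hqθ hi hσ₂ hσp hσq hσi hτ₂ hτp hτq hτi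
      hu0 hu1 hv hcubic hs₀ hs₁ hsp hσ0 hσ1 hσ2 hτ0 hτ1 hτ2

/-! ### Lemma 5.8 (= Lemma 4.10 with `β` replaced by `σ`) -/

/-- **Monsky 1990, Lemma 5.8 / Lemma 4.10, field form.** `q` an odd prime; `u ∈ ℚ` with
`u(u + 1)(u − 1) = −q v²`, `v ≠ 0`; `s₀ ∈ H` with `s₀² = u`; `σ` fixes `i` and `√q` and moves `√2`. Then
`σ s₀ = s₀`. Monsky p. 59: "Suppose on the contrary that `β(√u) = −√u`. Then `u` must be `±2 (square)`
or `±2p₇ (square)`. So the exponent to which `2` appears in `u³ − u` is odd, contradicting the fact that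
`u³ − u = −p₇v²`."  [cite: Monsky1990MockHeegner, Lemma 4.10 (p. 59), Lemma 5.8 (p. 63)] -/
theorem lemma58_field (σ : H →+* H) {θ₂ θq θi : H} {q : ℕ} (hq : q.Prime) (hq2 : q ≠ 2)
    (h₂ : θ₂ ^ 2 = 2) (hqθ : θq ^ 2 = q) (hi : θi ^ 2 = -1)
    (hσ₂ : σ θ₂ = -θ₂) (hσq : σ θq = θq) (hσi : σ θi = θi)
    {u v : ℚ} (hv : v ≠ 0) (hcubic : u * (u + 1) * (u - 1) = -(q : ℚ) * v ^ 2)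
    {s₀ : H} (hs₀ : s₀ ^ 2 = u) : σ s₀ = s₀ := by
  haveI := Fact.mk hq
  have hq0 : q ≠ 0 := hq.ne_zero
  have hu : u ≠ 0 := by
    rintro rfl
    simp at hcubic
    rcases hcubic with h | h
    · exact hq0 (by exact_mod_cast h)
    · exact hv h
  have hq2' : ¬ 2 ∣ q := fun h => hq2 ((Nat.prime_dvd_prime_iff_eq Nat.prime_two hq).mp h).symm
  have hu1 : u + 1 ≠ 0 := by
    intro h
    rw [h, mul_zero, zero_mul] at hcubic
    have : (q : ℚ) * v ^ 2 = 0 := by linear_combination hcubic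
    rcases mul_eq_zero.mp this with h' | h'
    · exact hq0 (by exact_mod_cast h')
    · exact hv (pow_eq_zero_iff two_ne_zero |>.mp h')
  have hu2 : u - 1 ≠ 0 := by
    intro h
    rw [h, mul_zero] at hcubic
    have : (q : ℚ) * v ^ 2 = 0 := by linear_combination hcubic
    rcases mul_eq_zero.mp this with h' | h'
    · exact hq0 (by exact_mod_cast h')
    · exact hv (pow_eq_zero_iff two_ne_zero |>.mp h')
  -- square class of `u` away from `{2, q}`
  have hval : ∀ ℓ : ℕ, ℓ.Prime → ℓ ≠ 2 → ℓ ≠ q → Even (padicValRat ℓ u) := by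
    intro ℓ hℓ hℓ2 hℓq
    haveI := Fact.mk hℓ
    refine (even_padicValRat_of_cubic ℓ hq0 ?_ hv hcubic).1
    intro hd
    rcases (Nat.Prime.dvd_mul hℓ).mp hd with h' | h'
    · exact hℓ2 ((Nat.prime_dvd_prime_iff_eq hℓ Nat.prime_two).mp h')
    · exact hℓq ((Nat.prime_dvd_prime_iff_eq hℓ hq).mp h')
  haveI : Fact (Nat.Prime 2) := ⟨Nat.prime_two⟩
  obtain ⟨w, hw⟩ := Curve15A1.exists_abs_eq_sq_or₂ hu 2 q fun ℓ hℓ hℓ2 hℓq => hval ℓ hℓ hℓ2 hℓq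
  -- the sign of `σ` on `s₀` is `(−1)^a`, `a = ord₂ u mod 2`; if it is `−1` then `ord₂ u` is odd
  have hσ₂' : σ θ₂ = (-1) * θ₂ := by rw [hσ₂, neg_one_mul]
  have hσq' : σ θq = 1 * θq := by rw [hσq, one_mul]
  have hσi' : σ θi = 1 * θi := by rw [hσi, one_mul]
  have hs₀' : s₀ ≠ 0 := by
    intro h; rw [h, zero_pow two_ne_zero] at hs₀
    exact hu (by exact_mod_cast hs₀.symm)
  -- `ord₂(u(u+1)(u−1))` is even
  have hsum : Even (padicValRat 2 u + padicValRat 2 (u + 1) + padicValRat 2 (u - 1)) := by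
    have key := congrArg (padicValRat 2) hcubic
    rw [padicValRat.mul (mul_ne_zero hu hu1) hu2, padicValRat.mul hu hu1,
      padicValRat.mul (neg_ne_zero.mpr (by exact_mod_cast hq0)) (pow_ne_zero 2 hv), padicValRat.neg,
      padicValRat.pow, padicValRat.of_nat, padicValNat.eq_zero_of_not_dvd hq2'] at key
    rw [key]
    exact ⟨padicValRat 2 v, by omega⟩
  -- if `ord₂ u` were odd, `ord₂(u(u+1)(u−1))` would be odd
  have hodd : ¬ Odd (padicValRat 2 u) := by
    intro hodd
    have hne : padicValRat 2 u ≠ 0 := by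
      intro h; rw [h] at hodd; exact (Int.not_odd_iff_even.mpr ⟨0, rfl⟩) hodd
    rcases lt_or_gt_of_ne hne with hlt | hgt
    · have h1 : padicValRat 2 (u + 1) = padicValRat 2 u :=
        padicValRat.add_eq_of_lt hu1 hu one_ne_zero (by rw [padicValRat.one]; exact hlt)
      have h2 : padicValRat 2 (u - 1) = padicValRat 2 u := by
        have := padicValRat.add_eq_of_lt (p := 2) (q := u) (r := -1) (by rwa [← sub_eq_add_neg])
          hu (neg_ne_zero.mpr one_ne_zero) (by rw [padicValRat.neg, padicValRat.one]; exact hlt)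
        rwa [← sub_eq_add_neg] at this
      rw [h1, h2] at hsum
      obtain ⟨k, hk⟩ := hodd
      obtain ⟨m, hm⟩ := hsum
      omega
    · have h1 : padicValRat 2 (u + 1) = 0 := by
        have := padicValRat.add_eq_of_lt (p := 2) (q := 1) (r := u) (by rwa [add_comm]) one_ne_zero
          hu (by rw [padicValRat.one]; exact hgt)
        rwa [add_comm, padicValRat.one] at this
      have h2 : padicValRat 2 (u - 1) = 0 := by
        have := padicValRat.add_eq_of_lt (p := 2) (q := -1) (r := u)
          (by rw [neg_add_eq_sub]; exact hu2) (neg_ne_zero.mpr one_ne_zero) hu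
          (by rw [padicValRat.neg, padicValRat.one]; exact hgt)
        rwa [neg_add_eq_sub, padicValRat.neg, padicValRat.one] at this
      rw [h1, h2] at hsum
      obtain ⟨k, hk⟩ := hodd
      obtain ⟨m, hm⟩ := hsum
      omega
  have heven : Even (padicValRat 2 u) := Int.not_odd_iff_even.mp hodd
  -- hence the square class of `u` has no factor `2`, and `σ` fixes `s₀`
  have hw0 : w ≠ 0 := by
    rintro rfl
    rcases hw with h | h | h | h <;> simp at h <;> exact hu h
  have habs : ∀ {d : ℕ}, |u| = d * w ^ 2 → d ≠ 0 → padicValRat 2 u = padicValNat 2 d + 2 * padicValRat 2 w := by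
    intro d hd hd0
    have : padicValRat 2 u = padicValRat 2 |u| := by
      rcases abs_choice u with h | h <;> rw [h]
      rw [padicValRat.neg]
    rw [this, hd, padicValRat.mul (by exact_mod_cast hd0) (pow_ne_zero 2 hw0), padicValRat.of_nat,
      padicValRat.pow]
    push_cast
    ring
  -- in the two cases with a factor `2` the valuation is odd
  have hcase : |u| = w ^ 2 ∨ |u| = q * w ^ 2 := by
    rcases hw with h | h | h | h
    · exact Or.inl h
    · exfalso
      have := habs (d := 2) (by norm_num [h]) two_ne_zero
      rw [padicValNat_self] at this
      obtain ⟨m, hm⟩ := heven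
      omega
    · exact Or.inr h
    · exfalso
      have := habs (d := q * 2) (by norm_num [h]) (by positivity)
      rw [padicValNat.mul hq0 two_ne_zero, padicValNat_self,
        padicValNat.eq_zero_of_not_dvd hq2'] at this
      obtain ⟨m, hm⟩ := heven
      omega
  -- apply the sign lemma with `a = 0`
  have hsign : ∀ {b : ℕ}, b ≤ 1 → |u| = 2 ^ 0 * (q : ℚ) ^ b * (q : ℚ) ^ 0 * w ^ 2 → σ s₀ = s₀ := by
    intro b hb hx
    have hpθ' : θq ^ 2 = q := hqθ
    obtain ⟨h1, h2⟩ := map_sqrt_eq_sign_mul σ h₂ hpθ' hqθ hi hσ₂' hσq' hσq' hσi' hs₀ hx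
    rcases lt_or_gt_of_ne hu with hlt | hgt
    · rw [h2 hlt]; simp
    · rw [h1 hgt]; simp
  rcases hcase with h | h
  · exact hsign zero_le_one (by rw [h]; ring)
  · exact hsign le_rfl (by rw [h]; ring)

end Literature.NumberTheory.EllipticCurves.Monsky1990

end
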